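import Mathlib
import Literature.RepresentationTheory.FiniteGroups.KLRGradedCellularBasis

/-!
# Per-step bound, row half: the row charge below an entry of a standard Young tableau

Stub `stub_rowCharge_abs_le` of line `klr-graded-polynomial-method` (crux
`SnSubsetDichotomy.NoThresholdSubsetTriple`, stmt-MatrixMultiplication-8302).

For a standard Young tableau `T` of shape `μ ⊢ n` (growth sequence `T.1 j = (row, col)` of the
entry `j`) and an entry `k` in row `r`, the *row charge below `k`*
`Σ_{rows i > r} (−1)^i · [row i holds an odd number of entries < k]` has absolute value at most
the number of rows of `μ` strictly below row `r`, i.e. `colLen 0 − (r + 1)`.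

Proof.  Each summand has absolute value `≤ 1` and vanishes unless `r < i` and row `i` holds some
entry `j < k`; then the cell `(i, col j)` lies in the diagram, hence so does `(i, 0)`
(down-closure), i.e. `i < colLen 0`.  So the nonzero summands are indexed by a subset of the
open interval `(r, colLen 0)`, of size `colLen 0 − r − 1`; and `r < colLen 0` since the cell of
`k` lies in the diagram.
-/

open scoped BigOperators
open Literature.NumberTheory.DiophantineGeometry (StdFilling)

namespace Summit.MatrixMultiplication.MatrixMultiplication.Theorems

/-- The row of any entry of a standard filling of `μ` is `< colLen 0` (down-closure of the
diagram). [folklore] -/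
private theorem row_lt_colLen_zero {n : ℕ} {μ : Nat.Partition n}
    (T : StdFilling n μ.youngDiagram) (j : Fin n) : (T.1 j).1 < μ.youngDiagram.colLen 0 := by
  have hmem : ((T.1 j).1, (T.1 j).2) ∈ μ.youngDiagram := T.mem j
  exact YoungDiagram.mem_iff_lt_colLen.1
    (μ.youngDiagram.up_left_mem le_rfl (Nat.zero_le _) hmem)

set_option linter.dupNamespace false in
/-- PER-STEP BOUND, row half: the row charge below entry `k` is at most the number of rows of the
shape strictly below the row of `k`, hence at most `colLen 0 − 1`. -/
theorem stub_rowCharge_abs_le : ∀ (n : ℕ) (μ : Nat.Partition n) (T : StdFilling n μ.youngDiagram) (k : Fin n),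
    |∑ i ∈ Finset.range n, (if (T.1 k).1 < i ∧
        Odd ((Finset.univ.filter (fun j : Fin n => j < k ∧ (T.1 j).1 = i)).card) then (-1 : ℤ) ^ i else 0)|
      ≤ (μ.youngDiagram.colLen 0 : ℤ) - ((T.1 k).1 + 1 : ℕ) := by
  intro n μ T k
  set r := (T.1 k).1 with hr
  set C := μ.youngDiagram.colLen 0 with hC
  have hk : r < C := row_lt_colLen_zero T k
  -- a row holding an odd number of entries `< k` holds at least one, hence lies in the diagram
  have hrow : ∀ i, Odd ((Finset.univ.filter (fun j : Fin n => j < k ∧ (T.1 j).1 = i)).card) →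
      i < C := by
    intro i hi
    have hne : (Finset.univ.filter (fun j : Fin n => j < k ∧ (T.1 j).1 = i)).Nonempty := by
      rw [Finset.nonempty_iff_ne_empty]
      intro h
      rw [h, Finset.card_empty] at hi
      exact (Nat.not_odd_iff_even.2 Even.zero) hi
    obtain ⟨j, hj⟩ := hne
    obtain ⟨-, -, hji⟩ := Finset.mem_filter.1 hj
    exact hji ▸ row_lt_colLen_zero T j
  calc |∑ i ∈ Finset.range n, (if r < i ∧
          Odd ((Finset.univ.filter (fun j : Fin n => j < k ∧ (T.1 j).1 = i)).card)
          then (-1 : ℤ) ^ i else 0)|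
        ≤ ∑ i ∈ Finset.range n, |(if r < i ∧
          Odd ((Finset.univ.filter (fun j : Fin n => j < k ∧ (T.1 j).1 = i)).card)
          then (-1 : ℤ) ^ i else 0)| := Finset.abs_sum_le_sum_abs _ _
    _ ≤ ∑ i ∈ Finset.range n, (if r < i ∧ i < C then (1 : ℤ) else 0) := by
        refine Finset.sum_le_sum fun i _ => ?_
        by_cases h : r < i ∧
            Odd ((Finset.univ.filter (fun j : Fin n => j < k ∧ (T.1 j).1 = i)).card)
        · rw [if_pos h, if_pos ⟨h.1, hrow i h.2⟩, abs_pow, abs_neg, abs_one, one_pow]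
        · rw [if_neg h, abs_zero]
          split_ifs <;> norm_num
    _ = (((Finset.range n).filter (fun i => r < i ∧ i < C)).card : ℤ) :=
        (Finset.natCast_card_filter _ _).symm
    _ ≤ ((Finset.Ioo r C).card : ℤ) := by
        exact_mod_cast Finset.card_le_card fun i hi =>
          Finset.mem_Ioo.2 (Finset.mem_filter.1 hi).2
    _ = (C : ℤ) - ((r + 1 : ℕ) : ℤ) := by
        rw [Nat.card_Ioo]
        push_cast
        omega

end Summit.MatrixMultiplication.MatrixMultiplication.Theorems
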